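import Literature.NumberTheory.NumberFields.IdealSquareOfOddDegree
import Mathlib.NumberTheory.RamificationInertia.Unramified
import HarnessLib

/-!
# Prime exponents of a principal ideal that becomes an `n`-th power times a unit upstairs

Topic `NumberTheory/NumberFields`.  Theorem-only file (no definition, no named fact), elementary
Dedekind-domain arithmetic complementing `IdealSquareOfOddDegree.lean` (the case `n = 2`, odd degree):

* `count_eq_mul_count_of_eq_pow_mul` — for an extension of number fields `L/K`, `a ∈ 𝓞_K ∖ 0`,
  `a = gⁿ u` in `𝓞_L`, a prime `w ∣ v` with `w ∤ u`: `e(w|v) · v(a) = n · w(g)`;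
* `dvd_count_of_eq_pow_mul_of_ramificationIdx_eq_one` — hence **`n ∣ v(a)` as soon as some prime
  `w ∣ v` with `e(w|v) = 1` misses `u`** (e.g. `L/K` unramified at `v` and `u` an `S`-unit away from
  `v`); `dvd_count_of_eq_pow_of_isUnramifiedIn` — the case `u = 1`, `v` unramified in `L`;
* `exists_eq_pow_of_forall_count_dvd` — **a nonzero ideal all of whose prime exponents are divisible
  by `n` is an `n`-th power**.

These turn "`j = γ₂³`, `j − 1728 = γ₃²` in an extension unramified outside `6`" (Weber–Cox) into the
ideal-theoretic statements `(j) = 𝔞³`, `(j − 1728) = 𝔟²` prime by prime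
(Neukirch, *Algebraic Number Theory*, I §8: `v_𝔓(x) = e(𝔓|𝔭) v_𝔭(x)` for `x ∈ K`).

## References

* J. Neukirch, *Algebraic Number Theory* (1999), Ch. I §8 (Prop. 8.2 and the extension of
  valuations), Ch. I §3 (unique factorisation of ideals). [NeukirchANT1999]
-/

noncomputable section

open NumberField IsDedekindDomain IsDedekindDomain.HeightOneSpectrum Ideal UniqueFactorizationMonoid

namespace Literature.NumberTheory.NumberFields

universe u v

variable {K : Type u} {L : Type v} [Field K] [NumberField K] [Field L] [NumberField L] [Algebra K L]

/-- **`e(w|v) · v(a) = n · w(g)`** when `a = gⁿ u` in `𝓞_L` with `w(u) = 0`, for a prime `w` of `𝓞_L`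
above the prime `v` of `𝓞_K` and `a ∈ 𝓞_K ∖ 0` (extension of valuations, `w(a) = e(w|v) v(a)`).
[cite: NeukirchANT1999, Ch. I §8 Prop. 8.2] -/
theorem count_eq_mul_count_of_eq_pow_mul {a : 𝓞 K} (ha : a ≠ 0) {g u : 𝓞 L} {n : ℕ}
    (hg : algebraMap (𝓞 K) (𝓞 L) a = g ^ n * u) (v : HeightOneSpectrum (𝓞 K))
    (w : HeightOneSpectrum (𝓞 L)) [w.asIdeal.LiesOver v.asIdeal] (hu : u ∉ w.asIdeal) :
    v.asIdeal.ramificationIdx' w.asIdeal *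
        (Associates.mk v.asIdeal).count (Associates.mk (Ideal.span {a})).factors =
      n * (Associates.mk w.asIdeal).count (Associates.mk (Ideal.span {g})).factors := by
  have hgu0 : g ^ n * u ≠ 0 := by
    rw [← hg]
    exact (map_ne_zero_iff _ (FaithfulSMul.algebraMap_injective _ _)).mpr ha
  set c : ℕ := (Associates.mk v.asIdeal).count (Associates.mk (Ideal.span {a})).factors with hc
  set e : ℕ := v.asIdeal.ramificationIdx' w.asIdeal with he
  have huval : w.intValuation u = 1 := (intValuation_eq_one_iff (v := w)).mpr hu
  have hval := IsDedekindDomain.HeightOneSpectrum.intValuation_liesOver v w a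
  rw [hg, map_mul, map_pow, huval, mul_one, v.intValuation_if_neg ha] at hval
  -- the case `n = 0`: `a` is a unit at `w`, so `v(a) = 0`
  rcases Nat.eq_zero_or_pos n with hn | hn
  · subst hn
    rw [pow_zero, ← WithZero.exp_nsmul, ← WithZero.exp_zero, WithZero.exp_inj, nsmul_eq_mul] at hval
    have h : ((e * c : ℕ) : ℤ) = 0 := by push_cast; linarith
    rw [zero_mul]
    exact_mod_cast h
  have hg0 : g ≠ 0 := by
    intro h0
    rw [h0, zero_pow hn.ne', zero_mul] at hgu0
    exact hgu0 rfl
  set m : ℕ := (Associates.mk w.asIdeal).count (Associates.mk (Ideal.span {g})).factors with hm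
  rw [w.intValuation_if_neg hg0, ← WithZero.exp_nsmul, ← WithZero.exp_nsmul,
    WithZero.exp_inj] at hval
  have h : ((e * c : ℕ) : ℤ) = ((n * m : ℕ) : ℤ) := by
    rw [nsmul_eq_mul, nsmul_eq_mul] at hval
    push_cast at hval ⊢
    linarith
  exact_mod_cast h

/-- **`n ∣ v(a)` when `a = gⁿ u` upstairs and some prime `w ∣ v` with `e(w|v) = 1` misses `u`.**
[cite: NeukirchANT1999, Ch. I §8 Prop. 8.2] -/
theorem dvd_count_of_eq_pow_mul_of_ramificationIdx_eq_one {a : 𝓞 K} (ha : a ≠ 0) {g u : 𝓞 L}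
    {n : ℕ} (hg : algebraMap (𝓞 K) (𝓞 L) a = g ^ n * u) (v : HeightOneSpectrum (𝓞 K))
    (w : HeightOneSpectrum (𝓞 L)) [w.asIdeal.LiesOver v.asIdeal]
    (he : v.asIdeal.ramificationIdx' w.asIdeal = 1) (hu : u ∉ w.asIdeal) :
    n ∣ (Associates.mk v.asIdeal).count (Associates.mk (Ideal.span {a})).factors := by
  have h := count_eq_mul_count_of_eq_pow_mul ha hg v w hu
  rw [he, one_mul] at h
  exact Dvd.intro _ h.symm

/-- **`n ∣ v(a)` when `a = gⁿ` in an extension `L` in which `v` is unramified.**  (Every prime `w ∣ v`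
then has `e(w|v) = 1`; Mathlib `Algebra.IsUnramifiedIn`, `Ideal.ramificationIdx_eq_one_of_isUnramifiedAt`.)
[cite: NeukirchANT1999, Ch. I §8 Prop. 8.2] -/
theorem dvd_count_of_eq_pow_of_isUnramifiedIn {a : 𝓞 K} (ha : a ≠ 0) {g : 𝓞 L} {n : ℕ}
    (hg : algebraMap (𝓞 K) (𝓞 L) a = g ^ n) (v : HeightOneSpectrum (𝓞 K))
    (hunr : Algebra.IsUnramifiedIn (𝓞 L) v.asIdeal) :
    n ∣ (Associates.mk v.asIdeal).count (Associates.mk (Ideal.span {a})).factors := by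
  haveI := v.isMaximal
  obtain ⟨Q, hQmax, hQover⟩ := Ideal.exists_maximal_ideal_liesOver_of_isIntegral (S := 𝓞 L) v.asIdeal
  haveI := hQmax
  haveI := hQover
  have hQ0 : Q ≠ ⊥ := Ideal.ne_bot_of_liesOver_of_ne_bot v.ne_bot Q
  set w : HeightOneSpectrum (𝓞 L) := ⟨Q, hQmax.isPrime, hQ0⟩ with hw
  haveI : w.asIdeal.LiesOver v.asIdeal := hQover
  haveI : Algebra.IsUnramifiedAt (𝓞 K) w.asIdeal := hunr Q hQmax.isPrime hQover
  have he : v.asIdeal.ramificationIdx' w.asIdeal = 1 := by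
    rw [Ideal.ramificationIdx'_eq_ramificationIdx v.asIdeal w.asIdeal v.ne_bot]
    exact Ideal.ramificationIdx_eq_one_of_isUnramifiedAt
  refine dvd_count_of_eq_pow_mul_of_ramificationIdx_eq_one ha (u := 1) (by rw [hg, mul_one]) v w he ?_
  exact fun h1 => hQmax.ne_top ((Ideal.eq_top_iff_one _).mpr h1)

/-- **A nonzero ideal all of whose prime exponents are divisible by `n` is an `n`-th power** (in a
Dedekind domain). [cite: NeukirchANT1999, Ch. I §3 (unique factorisation of ideals)] -/
theorem exists_eq_pow_of_forall_count_dvd {R : Type*} [CommRing R] [IsDedekindDomain R] {I : Ideal R}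
    (hI : I ≠ ⊥) {n : ℕ}
    (hdvd : ∀ v : HeightOneSpectrum R, n ∣ (Associates.mk v.asIdeal).count (Associates.mk I).factors) :
    ∃ J : Ideal R, I = J ^ n := by
  classical
  rcases Nat.eq_zero_or_pos n with hn | hn
  · -- `n = 0`: all exponents vanish, so `I = ⊤ = J⁰`
    subst hn
    refine ⟨⊤, ?_⟩
    rw [pow_zero, ← Ideal.finprod_heightOneSpectrum_factorization hI]
    refine finprod_eq_one_of_forall_eq_one fun v ↦ ?_
    have h0 := hdvd v
    rw [Nat.zero_dvd] at h0
    change v.asIdeal ^ (Associates.mk v.asIdeal).count (Associates.mk I).factors = 1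
    rw [h0, pow_zero]
  set c : HeightOneSpectrum R → ℕ := fun v ↦
    (Associates.mk v.asIdeal).count (Associates.mk I).factors with hc
  refine ⟨∏ᶠ v : HeightOneSpectrum R, v.asIdeal ^ (c v / n), ?_⟩
  have hfin : Function.HasFiniteMulSupport fun v : HeightOneSpectrum R ↦ v.asIdeal ^ (c v / n) := by
    refine (Ideal.hasFiniteMulSupport hI).subset fun v hv ↦ ?_
    simp only [Function.mem_mulSupport] at hv ⊢
    intro h1
    apply hv
    have h0 : c v = 0 := by
      by_contra hne
      have hle : v.maxPowDividing I ≤ v.asIdeal := Ideal.pow_le_self hne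
      rw [h1, Ideal.one_eq_top, top_le_iff] at hle
      exact v.isPrime.ne_top hle
    rw [h0]
    simp
  rw [finprod_pow hfin]
  conv_lhs => rw [← Ideal.finprod_heightOneSpectrum_factorization hI]
  refine finprod_congr fun v ↦ ?_
  change v.asIdeal ^ c v = (v.asIdeal ^ (c v / n)) ^ n
  rw [← pow_mul]
  congr 1
  obtain ⟨k, hk⟩ := hdvd v
  change c v = n * k at hk
  rw [hk, Nat.mul_div_cancel_left k hn, Nat.mul_comm]

/-- Principal version: **if `(a)ₗ = (g)ⁿ` in an extension unramified at every prime (`u = 1`), then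
`(a) = 𝔞ⁿ`** — and more generally from prime-wise divisibility. [cite: NeukirchANT1999, Ch. I §3 and §8] -/
theorem exists_span_eq_pow_of_forall_count_dvd {a : 𝓞 K} (ha : a ≠ 0) {n : ℕ}
    (hdvd : ∀ v : HeightOneSpectrum (𝓞 K),
      n ∣ (Associates.mk v.asIdeal).count (Associates.mk (Ideal.span {a})).factors) :
    ∃ 𝔞 : Ideal (𝓞 K), Ideal.span {a} = 𝔞 ^ n :=
  exists_eq_pow_of_forall_count_dvd (by simpa using ha) hdvd

end Literature.NumberTheory.NumberFields

end
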